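import Mathlib
import HarnessLib
import Summits.Ventures.LatticeQCDFlow.Exactness.NCMCGeneralSpaceEstimatorBias
import Summits.Ventures.LatticeQCDFlow.Exactness.NCMCGeneralSpaceOverlap

/-!
# Hoeffding confidence for reported acceptance rates on a general state space

HONEST FRAMING: exact (Metropolis-corrected) sampling algorithms for lattice gauge theory;
figures of merit are autocorrelation/cost numbers at stated couplings and volumes; no
continuum-physics claim.

Venture `LatticeQCDFlow` (cell pub-lqcd), topic `Exactness`; FANOUT row 13 (`eng-snf`, GEN-12).
NEW WORK of the cell (elementary probability on product laws: Mathlib's Hoeffding lemma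
`ProbabilityTheory.hasSubgaussianMGF_of_mem_Icc`, Hoeffding's inequality
`HasSubgaussianMGF.measure_sum_ge_le_of_iIndepFun`, `iIndepFun_pi`), not a published result;
nothing is cited as a fact (W. Hoeffding, J. Amer. Statist. Assoc. 58 (1963) 13, named only).
Companion of `NCMCGeneralSpaceEstimatorChebyshev.lean` (finite-`N` Chebyshev for `dF` through
`1/ESS_F − 1`): the acceptance integrand is BOUNDED, so the reported mean acceptance enjoys an
exponential, variance-free confidence statement.

## Setting and content

`μ` a probability law on records `E`, `N ≥ 1` i.i.d. records under `Measure.pi (fun _ : Fin N => μ)`,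
`sampleMean g` the average of `g` over the records (`JarzynskiEstimatorBias.lean`).

* **`measureReal_sampleMean_sub_ge_le_exp`** / **`measureReal_sub_sampleMean_ge_le_exp`** —
  HOEFFDING, one tail each: for measurable `g` with values in `[0, 1]` and `t ≥ 0`,
  `μ^{⊗N} {Ȳ_N − E_μ g ≥ t} ≤ e^{−2Nt²}` and `μ^{⊗N} {E_μ g − Ȳ_N ≥ t} ≤ e^{−2Nt²}`;
  **`measureReal_abs_sampleMean_sub_ge_le`** — two-sided: `μ^{⊗N} {|Ȳ_N − E_μ g| ≥ t} ≤ 2e^{−2Nt²}`.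
* **`CrooksPair.measureReal_abs_sampleMean_accept_sub_ge_le`** — for every Crooks pair, every
  level constant `c`, `N ≥ 1` independent forward evolutions from prior equilibrium
  (law `Measure.pi (fun _ => P_F)`): the average of the `N` Metropolis acceptance probabilities
  `min(1, e^{−(W_i − c)})` deviates from the population acceptance
  `a_F(c) = E_{P_F}[min(1, e^{−(W−c)})]` by `t` or more with probability at most `2e^{−2Nt²}`,
  whatever the work law.  Reading for the engine / the referee (`acceptance` fields of boarded
  rows, `INVALID` planted controls): a reported mean acceptance from `N` independent proposals
  carries the value-free confidence radius `√(log(2/δ)/(2N))` at level `1 − δ`; together with the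
  population identities of `NCMCGeneralSpaceOverlap.lean` (`a_F(ΔF) = 1 − TV(P_F,P_R)`),
  `…DiagnosticsConsistency.lean` (`4(1 − acc)² ≤ 1/ESS_F − 1`) and `…PinskerFloor.lean`
  (`(1 − acc)² ≤ ⟨W_d⟩/2`) this is what a reported `(N, acceptance)` pair can be audited against.

Scope / NOT CLAIMED: independent proposals only (no autocorrelated chain of switch attempts); the
statement is about the average of acceptance PROBABILITIES `min(1, e^{−(W_i−c)})` — the Bernoulli
accept/reject coins are not part of the record space `E` here; no value for any concrete protocol.
-/

namespace Summit.Ventures.LatticeQCDFlow.Exactness.GeneralNCMC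

open MeasureTheory ProbabilityTheory Set Filter Finset
open scoped ENNReal NNReal Topology

variable {E : Type*} [MeasurableSpace E]

/-! ## Hoeffding for the sample mean of a `[0,1]`-valued observable over `N` i.i.d. records -/

/-- **Hoeffding, upper tail**: for a measurable `g` with values in `[0,1]`, `N ≥ 1` i.i.d. records
and `t ≥ 0`, `μ^{⊗N} {(1/N) Σ_i g(y i) − E_μ g ≥ t} ≤ exp(−2 N t²)`. -/
theorem measureReal_sampleMean_sub_ge_le_exp (μ : Measure E) [IsProbabilityMeasure μ] {g : E → ℝ}
    (hg : Measurable g) (h01 : ∀ a, g a ∈ Icc (0 : ℝ) 1) {N : ℕ} (hN : 0 < N) {t : ℝ} (ht : 0 ≤ t) :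
    (Measure.pi fun _ : Fin N => μ).real {y | t ≤ sampleMean g y - ∫ a, g a ∂μ} ≤
      Real.exp (-2 * N * t ^ 2) := by
  set P := Measure.pi fun _ : Fin N => μ with hP
  -- centred coordinates are independent and sub-Gaussian with parameter `1/4`
  have hindep : iIndepFun (fun (i : Fin N) (y : Fin N → E) => g (y i) - ∫ a, g a ∂μ) P :=
    (iIndepFun_pi (μ := fun _ : Fin N => μ) (X := fun _ : Fin N => g) fun _ => hg.aemeasurable).comp
      (fun _ x => x - ∫ a, g a ∂μ) fun _ => measurable_id.sub_const _
  have hmean : ∀ i : Fin N, ∫ y, g (y i) ∂P = ∫ a, g a ∂μ := fun i =>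
    integral_comp_eval_pi μ i hg.aestronglyMeasurable
  have hsub : ∀ i ∈ (univ : Finset (Fin N)),
      HasSubgaussianMGF (fun y : Fin N → E => g (y i) - ∫ a, g a ∂μ) ((‖(1 : ℝ) - 0‖₊ / 2) ^ 2) P := by
    intro i _
    have h := hasSubgaussianMGF_of_mem_Icc (μ := P) (X := fun y : Fin N → E => g (y i))
      (a := 0) (b := 1) (hg.comp (measurable_pi_apply i)).aemeasurable
      (Eventually.of_forall fun y => h01 (y i))
    rw [hmean i] at h
    exact h
  have hhoef := HasSubgaussianMGF.measure_sum_ge_le_of_iIndepFun hindep hsub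
    (ε := N * t) (by positivity)
  -- the event `{t ≤ Ȳ − m}` is the event `{N t ≤ Σ (g − m)}`
  have hNpos : (0 : ℝ) < N := by exact_mod_cast hN
  have hset : {y : Fin N → E | t ≤ sampleMean g y - ∫ a, g a ∂μ} =
      {y | (N : ℝ) * t ≤ ∑ i, (g (y i) - ∫ a, g a ∂μ)} := by
    ext y
    simp only [mem_setOf_eq, sampleMean, sum_sub_distrib, sum_const, card_univ, Fintype.card_fin,
      nsmul_eq_mul]
    rw [← sub_nonneg, ← sub_nonneg (a := (∑ i, g (y i)) - N * ∫ a, g a ∂μ)]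
    have hid : (∑ i, g (y i)) - (N : ℝ) * ∫ a, g a ∂μ - N * t =
        N * ((∑ i, g (y i)) / N - ∫ a, g a ∂μ - t) := by
      field_simp
    rw [hid]
    constructor
    · intro h
      positivity
    · intro h
      by_contra hneg
      rw [not_le] at hneg
      have := mul_neg_of_pos_of_neg hNpos hneg
      linarith
  rw [hset]
  refine hhoef.trans (le_of_eq ?_)
  congr 1
  simp only [sum_const, card_univ, Fintype.card_fin, nsmul_eq_mul, sub_zero, nnnorm_one]
  push_cast
  field_simp

/-- **Hoeffding, lower tail**: `μ^{⊗N} {E_μ g − (1/N) Σ_i g(y i) ≥ t} ≤ exp(−2 N t²)` (the upper tail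
for `1 − g`). -/
theorem measureReal_sub_sampleMean_ge_le_exp (μ : Measure E) [IsProbabilityMeasure μ] {g : E → ℝ}
    (hg : Measurable g) (h01 : ∀ a, g a ∈ Icc (0 : ℝ) 1) {N : ℕ} (hN : 0 < N) {t : ℝ} (ht : 0 ≤ t) :
    (Measure.pi fun _ : Fin N => μ).real {y | t ≤ (∫ a, g a ∂μ) - sampleMean g y} ≤
      Real.exp (-2 * N * t ^ 2) := by
  have h01' : ∀ a, 1 - g a ∈ Icc (0 : ℝ) 1 := fun a => by
    have := h01 a
    simp only [Set.mem_Icc] at this ⊢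
    constructor <;> linarith
  have h := measureReal_sampleMean_sub_ge_le_exp μ (g := fun a => 1 - g a)
    (measurable_const.sub hg) h01' hN ht
  have hint : ∫ a, (1 - g a) ∂μ = 1 - ∫ a, g a ∂μ := by
    rw [integral_sub (integrable_const 1) (Integrable.of_mem_Icc 0 1 hg.aemeasurable
      (Eventually.of_forall h01)), integral_const, smul_eq_mul, probReal_univ, one_mul]
  have hN' : (N : ℝ) ≠ 0 := by exact_mod_cast hN.ne'
  have hsm : ∀ y : Fin N → E, sampleMean (fun a => 1 - g a) y = 1 - sampleMean g y := fun y => by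
    unfold sampleMean
    rw [sum_sub_distrib, sum_const, card_univ, Fintype.card_fin, nsmul_eq_mul, mul_one]
    field_simp
  have hset : {y : Fin N → E | t ≤ sampleMean (fun a => 1 - g a) y - ∫ a, (1 - g a) ∂μ} =
      {y | t ≤ (∫ a, g a ∂μ) - sampleMean g y} := by
    ext y
    simp only [mem_setOf_eq, hsm y, hint]
    constructor <;> intro h <;> linarith
  rw [hset] at h
  exact h

/-- **Two-sided Hoeffding**: `μ^{⊗N} {|(1/N) Σ_i g(y i) − E_μ g| ≥ t} ≤ 2 exp(−2 N t²)`. -/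
theorem measureReal_abs_sampleMean_sub_ge_le (μ : Measure E) [IsProbabilityMeasure μ] {g : E → ℝ}
    (hg : Measurable g) (h01 : ∀ a, g a ∈ Icc (0 : ℝ) 1) {N : ℕ} (hN : 0 < N) {t : ℝ} (ht : 0 ≤ t) :
    (Measure.pi fun _ : Fin N => μ).real {y | t ≤ |sampleMean g y - ∫ a, g a ∂μ|} ≤
      2 * Real.exp (-2 * N * t ^ 2) := by
  have hU := measureReal_sampleMean_sub_ge_le_exp μ hg h01 hN ht
  have hL := measureReal_sub_sampleMean_ge_le_exp μ hg h01 hN ht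
  have hsub : {y : Fin N → E | t ≤ |sampleMean g y - ∫ a, g a ∂μ|} ⊆
      {y | t ≤ sampleMean g y - ∫ a, g a ∂μ} ∪ {y | t ≤ (∫ a, g a ∂μ) - sampleMean g y} := by
    intro y hy
    simp only [mem_setOf_eq, mem_union] at hy ⊢
    rcases le_abs'.1 hy with h | h
    · right
      linarith
    · left
      exact h
  calc (Measure.pi fun _ : Fin N => μ).real {y | t ≤ |sampleMean g y - ∫ a, g a ∂μ|}
      ≤ (Measure.pi fun _ : Fin N => μ).real
          ({y | t ≤ sampleMean g y - ∫ a, g a ∂μ} ∪ {y | t ≤ (∫ a, g a ∂μ) - sampleMean g y}) :=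
        measureReal_mono hsub
    _ ≤ (Measure.pi fun _ : Fin N => μ).real {y | t ≤ sampleMean g y - ∫ a, g a ∂μ} +
          (Measure.pi fun _ : Fin N => μ).real {y | t ≤ (∫ a, g a ∂μ) - sampleMean g y} :=
        measureReal_union_le _ _
    _ ≤ 2 * Real.exp (-2 * N * t ^ 2) := by linarith

/-! ## For a Crooks pair: the reported mean acceptance of `N` independent switch proposals -/

namespace CrooksPair

variable {Ω : Type*} [MeasurableSpace Ω]
variable {ν₀ ν₁ : Measure Ω} {κF κR : Kernel Ω E} {s e : E → Ω} {W : E → ℝ}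

/-- **Hoeffding confidence for the reported mean acceptance.**  For every Crooks pair, every level
constant `c`, `N ≥ 1` independent forward evolutions from prior equilibrium and `t ≥ 0`: the
average of the `N` Metropolis acceptance probabilities `min(1, e^{−(W_i − c)})` deviates from the
population acceptance `a_F(c) = E_{P_F}[min(1, e^{−(W−c)})]` by `t` or more with probability at
most `2 exp(−2 N t²)` — whatever the work law. -/
theorem measureReal_abs_sampleMean_accept_sub_ge_le [IsFiniteMeasure ν₀] [IsMarkovKernel κF]
    (h0 : ν₀ univ ≠ 0) (h : CrooksPair ν₀ ν₁ κF κR s e W) (c : ℝ) {N : ℕ} (hN : 0 < N) {t : ℝ}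
    (ht : 0 ≤ t) :
    haveI := isProbabilityMeasure_fwdPathLaw ν₀ h0 κF
    (Measure.pi fun _ : Fin N => fwdPathLaw ν₀ κF).real
        {y | t ≤ |sampleMean (fun ε => min 1 (Real.exp (-(W ε - c)))) y -
          ∫ ε, min 1 (Real.exp (-(W ε - c))) ∂(fwdPathLaw ν₀ κF)|} ≤
      2 * Real.exp (-2 * N * t ^ 2) := by
  haveI := isProbabilityMeasure_fwdPathLaw ν₀ h0 κF
  refine measureReal_abs_sampleMean_sub_ge_le (fwdPathLaw ν₀ κF)
    (g := fun ε => min 1 (Real.exp (-(W ε - c))))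
    (measurable_const.min (Real.measurable_exp.comp (h.measurable_W.sub measurable_const).neg))
    (fun ε => ⟨le_min zero_le_one (Real.exp_pos _).le, min_le_left _ _⟩) hN ht

end CrooksPair

end Summit.Ventures.LatticeQCDFlow.Exactness.GeneralNCMC
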